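import Mathlib
import Summits.Schanuel.Schanuel.Theses.RecursiveCore
import Literature.NumberTheory.Transcendental.SchanuelEclEmptyProofs
import Literature.NumberTheory.Transcendental.KirbyWeakSchanuelAx
import Literature.NumberTheory.Transcendental.EclPregeometryProofs

/-!
# Birth skeleton (BC3) for crux `OffRecursiveSchanuel` (stmt-Schanuel-12195, route `RecursiveCore`)

The crux is Schanuel's conjecture RELATIVE TO THE RECURSIVE CORE
`𝓡 = span_ℚ {w | w ∈ span_ℚ(u) for some recursive tuple u}` (a tuple `u` is *recursive* when every
`e^{uᵢ}` is algebraic over `ℚ(u)`): for every recursive tuple `v` and every `x ∈ ℂᵐ` that is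
`ℚ`-free modulo `𝓡`,

  `trdeg_ℚ ℚ(v, eᵛ) + m ≤ trdeg_ℚ ℚ(v, eᵛ, x, eˣ)`.

This file registers the KIRBY SPLIT of that statement along the exponential-algebraic closure
`E = ecl(∅) ⊆ ℂ` (J. Kirby, *Exponential algebraicity in exponential fields*, Bull. LMS 42 (2010),
Thm. 1.2 and Prop. 7.2; in tree: `Literature.NumberTheory.Transcendental.kirby_relative_schanuel_complex_holds`,
PROVED from Ax 1971 Thm. 3) — the route's own foreseen split (iv) "x inside ecl(∅) → the rest":

* `stub_offRecursiveInsideEcl` (THE HEART, open): the crux for tuples `x` all of whose coordinates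
  lie in the countable field `ecl(∅)` — by Kirby's Prop. 7.2 the only place where an essential
  counterexample to Schanuel can live; instances (granted the freeness hypotheses, which Schanuel
  predicts): `v = (iπ), x = (1)` (e ⊥ π), `v = (), x = (1, e)` (e ⊥ eᵉ).
* `stub_recursive_subset_ecl` (provable now, M): every recursive tuple lies in `ecl(∅)` —
  equivalently `𝓡 ⊆ ecl(∅)` — by Kirby's Thm. 1.2 WITH the dimension term
  (`succ_le_relTrdeg_of_isEclClosed` / `card_succ_le_relTrdeg_of_isEclClosed`, proved in tree):
  a recursive tuple not inside `C = ecl ∅` would have a part `w` of rank `r ≥ 1` free modulo `C`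
  with `r + 1 ≤ trdeg_{ℚ(C)} ℚ(C)(w, eʷ) = trdeg_{ℚ(C)} ℚ(C)(w) ≤ r`.

The composition `offRecursiveSchanuel_of_pieces : stub₁-sig → stub₂-sig → ⟨crux, unfolded⟩` is
PROVED here (no `sorry`): for `x` free modulo `𝓡` let `V = span_ℚ(x)`, `W = V ⊓ E` with basis `y`
(`k'` vectors, inside `E`, free modulo `𝓡` because `V ⊓ 𝓡 = 0`), `U` a complement of `W` in `V` with
basis `z` (`m'` vectors, free modulo `E`), `k' + m' = m`, denominators cleared so that
`ℚ(y, z, eʸ, eᶻ) ⊆ ℚ(x, eˣ)`; the inside stub at `(v, y)` gives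
`trdeg ℚ(v, eᵛ) + k' ≤ trdeg ℚ(v, eᵛ, y, eʸ)`; Kirby's theorem at `z` gives
`m' ≤ trdeg_{ℚ(E)} ℚ(E)(z, eᶻ) ≤ trdeg_{ℚ(v,eᵛ,y,eʸ)} ℚ(v, eᵛ, y, eʸ)(z, eᶻ)` (base change DOWN
along `ℚ(v, eᵛ, y, eʸ) ⊆ ℚ(E)`, which is where `stub_recursive_subset_ecl` and `exp E ⊆ E` enter);
the tower law adds the two and monotonicity along `ℚ(v, eᵛ, y, eʸ, z, eᶻ) ⊆ ℚ(v, eᵛ, x, eˣ)`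
concludes. `OffRecursiveSchanuel_of` restates it with the crux BY NAME; the only sorries of the
file are the two stubs.
-/

set_option linter.dupNamespace false

noncomputable section

namespace Summit.Schanuel.Schanuel.Cruxes.OffRecursiveSchanuel.Birth

open Summit.Schanuel.Schanuel.Theses.RecursiveCore
open IntermediateField

/-! ## The two registered stubs -/

/-- **STUB 1 (the heart): Schanuel relative to the recursive core, INSIDE `ecl(∅)`.**
For every recursive tuple `v` (every `e^{vᵢ}` algebraic over `ℚ(v)`) and every tuple `x` of
exponentially algebraic numbers (`xⱼ ∈ ecl ∅`) that is `ℚ`-free modulo the recursive core `𝓡`,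
`trdeg_ℚ ℚ(v, eᵛ) + m ≤ trdeg_ℚ ℚ(v, eᵛ, x, eˣ)`. The crux restricted to the countable field
`ecl(∅)`, where by Kirby 2010 Prop. 7.2 every essential counterexample to Schanuel lives; a
consequence of Schanuel's conjecture (route support `SplitOfSchanuel`); open. -/
theorem stub_offRecursiveInsideEcl :
    ∀ (k m : ℕ) (v : Fin k → ℂ) (x : Fin m → ℂ),
      (∀ i, IsAlgebraic (IntermediateField.adjoin ℚ (Set.range v)) (Complex.exp (v i))) →
      (∀ j, x j ∈ Literature.NumberTheory.Transcendental.ecl (∅ : Set ℂ)) →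
      LinearIndependent ℚ ((Submodule.span ℚ {w : ℂ | ∃ (j : ℕ) (u : Fin j → ℂ),
        (∀ i, IsAlgebraic (IntermediateField.adjoin ℚ (Set.range u)) (Complex.exp (u i))) ∧
          w ∈ Submodule.span ℚ (Set.range u)}).mkQ ∘ x) →
      Algebra.trdeg ℚ (IntermediateField.adjoin ℚ (Set.range v ∪ Set.range (Complex.exp ∘ v))) +
          (m : Cardinal) ≤
        Algebra.trdeg ℚ (IntermediateField.adjoin ℚ
          (Set.range v ∪ Set.range (Complex.exp ∘ v) ∪
            (Set.range x ∪ Set.range (Complex.exp ∘ x)))) := by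
  sorry

/-- **STUB 2: recursive tuples are exponentially algebraic** (`𝓡 ⊆ ecl(∅)`).
If every `e^{vᵢ}` is algebraic over `ℚ(v₁, …, v_k)` then every `vᵢ` lies in Kirby's
exponential-algebraic closure `ecl(∅)` of `ℂ_exp`. Provable now from Kirby 2010 Thm. 1.2 with the
dimension term (tree: `Literature.NumberTheory.Transcendental.succ_le_relTrdeg_of_isEclClosed`,
`card_succ_le_relTrdeg_of_isEclClosed`, from Ax 1971): a part `w` of `span_ℚ(v)` of rank `r ≥ 1`
free modulo `C = ecl ∅` would give `r + 1 ≤ trdeg_{ℚ(C)} ℚ(C)(w, eʷ)`, while `ℚ(C)(w, eʷ)` is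
algebraic over `ℚ(C)(w)` (each `e^{N wⱼ}` is a monomial in the `e^{vᵢ}`, algebraic over
`ℚ(v) ⊆ ℚ(C)(w)`), so that transcendence degree is `≤ r`. -/
theorem stub_recursive_subset_ecl :
    ∀ (k : ℕ) (v : Fin k → ℂ),
      (∀ i, IsAlgebraic (IntermediateField.adjoin ℚ (Set.range v)) (Complex.exp (v i))) →
      ∀ i, v i ∈ Literature.NumberTheory.Transcendental.ecl (∅ : Set ℂ) := by
  sorry

/-! ## Bookkeeping -/

open Submodule in
/-- Freeness modulo a subspace `N` makes `span_ℚ(x)` disjoint from `N`. [folklore] -/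
theorem disjoint_span_of_free {n : ℕ} {x : Fin n → ℂ} (N : Submodule ℚ ℂ)
    (hx : LinearIndependent ℚ (N.mkQ ∘ x)) : Disjoint (span ℚ (Set.range x)) N := by
  rw [disjoint_def]
  intro u hu huN
  obtain ⟨c, rfl⟩ := (mem_span_range_iff_exists_fun ℚ).1 hu
  have h0 : ∑ i, c i • (N.mkQ ∘ x) i = 0 := by
    have : N.mkQ (∑ i, c i • x i) = 0 := (Submodule.Quotient.mk_eq_zero N).2 huN
    simpa [map_sum, map_smul] using this
  have hc := Fintype.linearIndependent_iff.1 hx c h0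
  simp [hc]

/-! ## The composition -/

open Submodule in
/-- **The composition, crux statement UNFOLDED** (PROVED, no sorry): the two stub statements,
verbatim, imply the statement of `OffRecursiveSchanuel` — Kirby's `GL_m(ℚ)` reduction along
`E = ecl(∅)` (the proof of `schanuelConjecture_iff_ecl_empty_of_kirby`, run with the recursive
tuple `v` carried in the base and freeness modulo `𝓡` carried to the inside part). -/
theorem offRecursiveSchanuel_of_pieces
    (hI : ∀ (k m : ℕ) (v : Fin k → ℂ) (x : Fin m → ℂ),
      (∀ i, IsAlgebraic (IntermediateField.adjoin ℚ (Set.range v)) (Complex.exp (v i))) →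
      (∀ j, x j ∈ Literature.NumberTheory.Transcendental.ecl (∅ : Set ℂ)) →
      LinearIndependent ℚ ((Submodule.span ℚ {w : ℂ | ∃ (j : ℕ) (u : Fin j → ℂ),
        (∀ i, IsAlgebraic (IntermediateField.adjoin ℚ (Set.range u)) (Complex.exp (u i))) ∧
          w ∈ Submodule.span ℚ (Set.range u)}).mkQ ∘ x) →
      Algebra.trdeg ℚ (IntermediateField.adjoin ℚ (Set.range v ∪ Set.range (Complex.exp ∘ v))) +
          (m : Cardinal) ≤
        Algebra.trdeg ℚ (IntermediateField.adjoin ℚ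
          (Set.range v ∪ Set.range (Complex.exp ∘ v) ∪
            (Set.range x ∪ Set.range (Complex.exp ∘ x)))))
    (hE : ∀ (k : ℕ) (v : Fin k → ℂ),
      (∀ i, IsAlgebraic (IntermediateField.adjoin ℚ (Set.range v)) (Complex.exp (v i))) →
      ∀ i, v i ∈ Literature.NumberTheory.Transcendental.ecl (∅ : Set ℂ)) :
    ∀ (k m : ℕ) (v : Fin k → ℂ) (x : Fin m → ℂ),
      (∀ i, IsAlgebraic (IntermediateField.adjoin ℚ (Set.range v)) (Complex.exp (v i))) →
      LinearIndependent ℚ ((Submodule.span ℚ {w : ℂ | ∃ (j : ℕ) (u : Fin j → ℂ),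
        (∀ i, IsAlgebraic (IntermediateField.adjoin ℚ (Set.range u)) (Complex.exp (u i))) ∧
          w ∈ Submodule.span ℚ (Set.range u)}).mkQ ∘ x) →
      Algebra.trdeg ℚ (IntermediateField.adjoin ℚ (Set.range v ∪ Set.range (Complex.exp ∘ v))) +
          (m : Cardinal) ≤
        Algebra.trdeg ℚ (IntermediateField.adjoin ℚ
          (Set.range v ∪ Set.range (Complex.exp ∘ v) ∪
            (Set.range x ∪ Set.range (Complex.exp ∘ x)))) := by
  intro k m v x hv hx
  -- the recursive core `𝓡` as a `ℚ`-subspace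
  set R : Submodule ℚ ℂ := span ℚ {w : ℂ | ∃ (j : ℕ) (u : Fin j → ℂ),
    (∀ i, IsAlgebraic (IntermediateField.adjoin ℚ (Set.range u)) (Complex.exp (u i))) ∧
      w ∈ span ℚ (Set.range u)} with hR
  -- `E = ecl ∅` as a `ℚ`-subspace of `ℂ`, closed under `exp`
  obtain ⟨⟨SE, hSE⟩, hexp⟩ :=
    Literature.NumberTheory.Transcendental.Kirby2010_ecl_isExpSubfield_holds ℂ (∅ : Set ℂ)
  let Eq : Submodule ℚ ℂ :=
    { carrier := Literature.NumberTheory.Transcendental.ecl (∅ : Set ℂ)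
      add_mem' := fun {a b} ha hb => by
        rw [← hSE] at ha hb ⊢; exact SE.add_mem ha hb
      zero_mem' := by rw [← hSE]; exact SE.zero_mem
      smul_mem' := fun q {a} ha => by
        rw [← hSE] at ha ⊢
        rw [Rat.smul_def]
        exact SE.mul_mem (SubfieldClass.ratCast_mem SE q) ha }
  have hEq : (Eq : Set ℂ) = Literature.NumberTheory.Transcendental.ecl (∅ : Set ℂ) := rfl
  have hspanE : span ℚ (Literature.NumberTheory.Transcendental.ecl (∅ : Set ℂ)) = Eq := by
    rw [← hEq, span_eq]
  -- the `ℚ`-span `V` of `x`, `W = V ∩ E` and a complement `U` of `W` in `V`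
  have hxli : LinearIndependent ℚ x := LinearIndependent.of_comp _ hx
  set V : Submodule ℚ ℂ := span ℚ (Set.range x) with hV
  have hVR : Disjoint V R := disjoint_span_of_free R hx
  haveI : FiniteDimensional ℚ V := FiniteDimensional.span_of_finite ℚ (Set.finite_range x)
  set W : Submodule ℚ ℂ := V ⊓ Eq with hW
  obtain ⟨U', hU'⟩ := W.exists_isCompl
  set U : Submodule ℚ ℂ := V ⊓ U' with hU
  haveI : FiniteDimensional ℚ W := Submodule.finiteDimensional_of_le inf_le_left
  haveI : FiniteDimensional ℚ U := Submodule.finiteDimensional_of_le inf_le_left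
  have hWU_sup : W ⊔ U = V := by
    rw [hU, inf_comm, ← sup_inf_assoc_of_le U' (inf_le_left : W ≤ V), hU'.sup_eq_top, top_inf_eq]
  have hWU_disj : Disjoint W U := hU'.disjoint.mono_right inf_le_right
  have hUE_disj : Disjoint U Eq := by
    rw [disjoint_def]
    intro a haU haE
    exact (disjoint_def.mp hWU_disj) a ⟨inf_le_left (b := U') haU, haE⟩ haU
  -- dimensions
  set k' := Module.finrank ℚ W
  set m' := Module.finrank ℚ U
  have hn : k' + m' = m := by
    have h1 := Submodule.finrank_sup_add_finrank_inf_eq W U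
    rw [hWU_disj.eq_bot, finrank_bot, add_zero, hWU_sup] at h1
    rw [← h1, hV, finrank_span_eq_card hxli, Fintype.card_fin]
  -- bases
  let bW := Module.finBasis ℚ W
  let bU := Module.finBasis ℚ U
  let y : Fin k' → ℂ := fun i => (bW i : ℂ)
  let z : Fin m' → ℂ := fun j => (bU j : ℂ)
  have hy_mem : ∀ i, y i ∈ Literature.NumberTheory.Transcendental.ecl (∅ : Set ℂ) := fun i =>
    ((bW i).2 : (bW i : ℂ) ∈ V ⊓ Eq).2
  have hy_V : ∀ i, y i ∈ V := fun i => ((bW i).2 : (bW i : ℂ) ∈ V ⊓ Eq).1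
  have hz_U : ∀ j, z j ∈ U := fun j => (bU j).2
  have hz_V : ∀ j, z j ∈ V := fun j => inf_le_left (b := U') (hz_U j)
  have hy_li : LinearIndependent ℚ y := bW.linearIndependent.map' W.subtype W.ker_subtype
  have hz_li : LinearIndependent ℚ z := bU.linearIndependent.map' U.subtype U.ker_subtype
  -- clearing denominators
  choose Ny hNy hNy_mem using fun i =>
    Literature.NumberTheory.Transcendental.exists_nsmul_mem_span_int x (hy_V i)
  choose Nz hNz hNz_mem using fun j =>
    Literature.NumberTheory.Transcendental.exists_nsmul_mem_span_int x (hz_V j)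
  let cy : Fin k' → ℚˣ := fun i => Units.mk0 (Ny i : ℚ) (Nat.cast_ne_zero.mpr (hNy i))
  let cz : Fin m' → ℚˣ := fun j => Units.mk0 (Nz j : ℚ) (Nat.cast_ne_zero.mpr (hNz j))
  let y' : Fin k' → ℂ := fun i => (Ny i : ℚ) • y i
  let z' : Fin m' → ℂ := fun j => (Nz j : ℚ) • z j
  have hy'_eq : cy • y = y' := by
    funext i; simp only [Pi.smul_apply', cy, y', Units.smul_def, Units.val_mk0]
  have hz'_eq : cz • z = z' := by
    funext j; simp only [Pi.smul_apply', cz, z', Units.smul_def, Units.val_mk0]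
  have hy'_li : LinearIndependent ℚ y' := hy'_eq ▸ hy_li.units_smul cy
  have hz'_li : LinearIndependent ℚ z' := hz'_eq ▸ hz_li.units_smul cz
  have hy'_mem : ∀ i, y' i ∈ Literature.NumberTheory.Transcendental.ecl (∅ : Set ℂ) := fun i =>
    Eq.smul_mem _ (hy_mem i)
  have hy'_V : ∀ i, y' i ∈ V := fun i => V.smul_mem _ (hy_V i)
  have hz'_U : ∀ j, z' j ∈ U := fun j => U.smul_mem _ (hz_U j)
  -- `y'` is free modulo the recursive core (because `x` is), `z'` is free modulo `E`
  have hy'_free : LinearIndependent ℚ (R.mkQ ∘ y') := by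
    refine hy'_li.map ?_
    rw [ker_mkQ]
    exact hVR.mono_left (span_le.mpr (Set.range_subset_iff.mpr hy'_V))
  have hz'_modE : LinearIndependent ℚ
      ((span ℚ (Literature.NumberTheory.Transcendental.ecl (∅ : Set ℂ))).mkQ ∘ z') := by
    refine hz'_li.map ?_
    rw [ker_mkQ, hspanE]
    exact hUE_disj.mono_left (span_le.mpr (Set.range_subset_iff.mpr hz'_U))
  -- the field-theoretic estimate
  set Sv := Set.range v ∪ Set.range (Complex.exp ∘ v) with hSv
  set Sy := Set.range y' ∪ Set.range (Complex.exp ∘ y') with hSy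
  set Sz := Set.range z' ∪ Set.range (Complex.exp ∘ z') with hSz
  set Kvy := IntermediateField.adjoin ℚ (Sv ∪ Sy) with hKvy
  set L := IntermediateField.adjoin ℚ (Literature.NumberTheory.Transcendental.ecl (∅ : Set ℂ)) with hL
  -- inside count at `(v, y')`
  have hk : Algebra.trdeg ℚ (IntermediateField.adjoin ℚ Sv) + (k' : Cardinal) ≤
      Algebra.trdeg ℚ Kvy := hI k k' v y' hv hy'_mem hy'_free
  -- outside count at `z'` (Kirby's relative Schanuel theorem over `ecl ∅`, proved in tree)
  have hm₀ : (m' : Cardinal) ≤ Algebra.trdeg L (IntermediateField.adjoin L Sz) :=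
    Literature.NumberTheory.Transcendental.kirby_relative_schanuel_complex_holds m' z' hz'_modE
  -- base change DOWN along `ℚ(v, eᵛ, y', e^{y'}) ⊆ ℚ(ecl ∅)`
  have hvE : ∀ i, v i ∈ Literature.NumberTheory.Transcendental.ecl (∅ : Set ℂ) := hE k v hv
  have hKvyL : Kvy ≤ L := by
    rw [hKvy, adjoin_le_iff]
    rintro a ((⟨i, rfl⟩ | ⟨i, rfl⟩) | (⟨i, rfl⟩ | ⟨i, rfl⟩))
    · exact subset_adjoin ℚ _ (hvE i)
    · exact subset_adjoin ℚ _ (hexp _ (hvE i))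
    · exact subset_adjoin ℚ _ (hy'_mem i)
    · exact subset_adjoin ℚ _ (hexp _ (hy'_mem i))
  have hm : (m' : Cardinal) ≤ Algebra.trdeg Kvy (IntermediateField.adjoin Kvy Sz) :=
    hm₀.trans (Literature.NumberTheory.Transcendental.trdeg_adjoin_le_of_le hKvyL Sz)
  -- tower
  have hkm : Algebra.trdeg ℚ (IntermediateField.adjoin ℚ Sv) + (k' : Cardinal) + m' ≤
      Algebra.trdeg ℚ (IntermediateField.adjoin ℚ ((Sv ∪ Sy) ∪ Sz)) :=
    Literature.NumberTheory.Transcendental.add_le_trdeg_adjoin_union (Sv ∪ Sy) Sz hk hm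
  -- comparison with `ℚ(v, eᵛ, x, eˣ)`
  set Kx := IntermediateField.adjoin ℚ (Sv ∪ (Set.range x ∪ Set.range (Complex.exp ∘ x)))
    with hKx
  have hsub : IntermediateField.adjoin ℚ (Set.range x ∪ Set.range (Complex.exp ∘ x)) ≤ Kx :=
    adjoin.mono ℚ _ _ Set.subset_union_right
  have hle : IntermediateField.adjoin ℚ ((Sv ∪ Sy) ∪ Sz) ≤ Kx := by
    rw [adjoin_le_iff]
    rintro a (((⟨i, rfl⟩ | ⟨i, rfl⟩) | (⟨i, rfl⟩ | ⟨i, rfl⟩)) | (⟨j, rfl⟩ | ⟨j, rfl⟩))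
    · exact subset_adjoin ℚ _ (Or.inl (Or.inl ⟨i, rfl⟩))
    · exact subset_adjoin ℚ _ (Or.inl (Or.inr ⟨i, rfl⟩))
    · exact hsub (Literature.NumberTheory.Transcendental.mem_adjoin_of_mem_span_int x (hNy_mem i)).1
    · exact hsub (Literature.NumberTheory.Transcendental.mem_adjoin_of_mem_span_int x (hNy_mem i)).2
    · exact hsub (Literature.NumberTheory.Transcendental.mem_adjoin_of_mem_span_int x (hNz_mem j)).1
    · exact hsub (Literature.NumberTheory.Transcendental.mem_adjoin_of_mem_span_int x (hNz_mem j)).2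
  have hfin : Algebra.trdeg ℚ (IntermediateField.adjoin ℚ ((Sv ∪ Sy) ∪ Sz)) ≤ Algebra.trdeg ℚ Kx :=
    trdeg_le_of_injective (inclusion hle) (inclusion_injective hle)
  calc Algebra.trdeg ℚ (IntermediateField.adjoin ℚ Sv) + (m : Cardinal)
        = Algebra.trdeg ℚ (IntermediateField.adjoin ℚ Sv) + (k' : Cardinal) + m' := by
          rw [← hn, Nat.cast_add, add_assoc]
    _ ≤ Algebra.trdeg ℚ (IntermediateField.adjoin ℚ ((Sv ∪ Sy) ∪ Sz)) := hkm
    _ ≤ Algebra.trdeg ℚ Kx := hfin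

/-- **The skeleton theorem: the crux BY NAME from exactly the two registered stubs' statements.**
`OffRecursiveSchanuel` (item stmt-Schanuel-12195 of route RecursiveCore) follows from the
statements of `stub_offRecursiveInsideEcl` and `stub_recursive_subset_ecl` by the proved
composition `offRecursiveSchanuel_of_pieces` (no sorry in this theorem or its proof). -/
theorem OffRecursiveSchanuel_of
    (hI : ∀ (k m : ℕ) (v : Fin k → ℂ) (x : Fin m → ℂ),
      (∀ i, IsAlgebraic (IntermediateField.adjoin ℚ (Set.range v)) (Complex.exp (v i))) →
      (∀ j, x j ∈ Literature.NumberTheory.Transcendental.ecl (∅ : Set ℂ)) →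
      LinearIndependent ℚ ((Submodule.span ℚ {w : ℂ | ∃ (j : ℕ) (u : Fin j → ℂ),
        (∀ i, IsAlgebraic (IntermediateField.adjoin ℚ (Set.range u)) (Complex.exp (u i))) ∧
          w ∈ Submodule.span ℚ (Set.range u)}).mkQ ∘ x) →
      Algebra.trdeg ℚ (IntermediateField.adjoin ℚ (Set.range v ∪ Set.range (Complex.exp ∘ v))) +
          (m : Cardinal) ≤
        Algebra.trdeg ℚ (IntermediateField.adjoin ℚ
          (Set.range v ∪ Set.range (Complex.exp ∘ v) ∪
            (Set.range x ∪ Set.range (Complex.exp ∘ x)))))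
    (hE : ∀ (k : ℕ) (v : Fin k → ℂ),
      (∀ i, IsAlgebraic (IntermediateField.adjoin ℚ (Set.range v)) (Complex.exp (v i))) →
      ∀ i, v i ∈ Literature.NumberTheory.Transcendental.ecl (∅ : Set ℂ)) :
    OffRecursiveSchanuel :=
  offRecursiveSchanuel_of_pieces hI hE

/-- The two sorried stubs, by name, have verbatim the hypotheses of `OffRecursiveSchanuel_of`
(certifies the signatures; this declaration inherits `sorryAx` from the stubs and nothing else). -/
theorem offRecursiveSchanuel_of_stubs : OffRecursiveSchanuel :=
  OffRecursiveSchanuel_of stub_offRecursiveInsideEcl stub_recursive_subset_ecl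

end Summit.Schanuel.Schanuel.Cruxes.OffRecursiveSchanuel.Birth

end
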